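import Literature.MathematicalPhysics.StatisticalMechanics.MonomerDimerZeros
import Mathlib.Analysis.Complex.Polynomial.Basic
import Mathlib.Analysis.Complex.Polynomial.GaussLucas
import Mathlib.Algebra.Polynomial.Splits
import HarnessLib

/-!
# Heilmann–Lieb ratio bounds from zero-freeness alone (capacity partition functions at complex
# activity; Salmhofer–Seiler, CMP 139 (1991), Thm. 3.6 / Thm. 3.8, and the U(N) model)

A further file of the Salmhofer–Seiler series (`MonomerDimerZeros`, `CapacityPartitionFunctionConnectedness`,
`NJLMassAnalyticity`, …).  `MonomerDimerZeros` proves, for the capacity partition functions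
`Z(c) = [∏_x σ_x^{c_x}] ∏_x F_x(σ_x) ∏_b B_b(σ_{s b} σ_{t b})` of a complex spin system with
EXPONENTIAL site data `F_z = e^{a_z σ_z}` and EXPONENTIAL bond data `B_b = e^{w_b σσ'}`, `w_b ≥ 0`
(the monomer–dimer / NJL case), Heilmann–Lieb's theorem in the form Salmhofer–Seiler use it
(Thm. 3.6 and the volume-independent bounds behind Thm. 3.8 / the Erratum to Thm. 3.11):
`Z(c) ≠ 0` for `Re a_x > 0`, together with the RATIO BOUNDS `‖Z(c - δ_z)/Z(c)‖ ≤ c_z / Re a_z`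
(`MonomerDimer.heilmannLieb`, `norm_Z_div_Z_le_of_re`), both by the Heilmann–Lieb vertex recursion,
which exists only for exponential bond data.

For the `U(N)` lattice gauge theory at `β = 0` the bond data are NOT exponential
(`B(t) = ∑_{n ≤ N} (N-n)!/(N! n!) tⁿ`, Salmhofer–Seiler (2.16)–(2.23), (4.27)); Salmhofer–Seiler
therefore state the `U(N)` condensate bound (4.44) only conditionally («Assuming that clustering
holds for `m > 0` also in the `U(N)`-model», Remark 4.10 (3), p. 423).  The zero-freeness input for
`U(N)` exists in print in another guise — the `β = 0` `U(N)` partition function on a finite graph is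
`i^{N|V|} M_{N,G}(-im)` with `M_{d,G}` the `d`-matching polynomial of Hall–Puder–Sawin, which is
real-rooted [HallPuderSawin2018, §2.2 and §5.2], and whose multivariate version is stable
[Amini2019, Thm. 3.7] (cell memo `run/shared/lean/pub/pub-ymgap/qcd-lit/Y3-INPUTS-INPRINT.md` §30;
nothing of this is asserted in the present file).  What THIS file proves is the purely algebraic
hinge that makes such a zero-freeness statement usable by the rest of the series: **for ARBITRARY
bond Taylor data, the Heilmann–Lieb ratio bounds follow from zero-freeness in the single activity
`a_z` alone**, because lowering the capacity at `z` is differentiation in `a_z`: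

* `siteActivityPoly D s t f g c z ∈ ℂ[X]` — `Z(c)` as a polynomial in the activity at `z`, the other
  data frozen (`eval_siteActivityPoly`: its value at `w` is `Z(c)` with the site data at `z` replaced by
  `e^{w σ_z}`; `natDegree_siteActivityPoly_le`: degree `≤ c_z`);
* **`eval_derivative_siteActivityPoly`**: its derivative evaluates to `Z(c - δ_z)` (`z ∈ supp c`);
* **`norm_Z_sub_single_div_Z_le_of_zeroFree`**: if `Z(c) ≠ 0` whenever `ε Re a_z > 0` (`ε = ±1`,
  everything else frozen), then at the actual activity, `ε Re a_z > 0`,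
  `‖Z(c - δ_z)/Z(c)‖ ≤ c_z / (ε Re a_z)` and `ε Re (Z(c - δ_z)/Z(c)) ≥ 0`
  (`re_Z_sub_single_div_Z_nonneg_of_zeroFree`) — proof: the roots `r` of the activity polynomial have
  `ε Re r ≤ 0` (`re_root_nonpos_of_zeroFree`), and `Z(c-δ_z)/Z(c) = ∑_r (a_z - r)⁻¹`
  (Mathlib's `Polynomial.Splits.eval_derivative_div_eval_of_ne_zero`), each term of modulus
  `≤ (ε Re a_z)⁻¹`;
* **`Z_sub_single_ne_zero_of_zeroFree`** (Gauss–Lucas, Mathlib's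
  `Polynomial.rootSet_derivative_subset_convexHull_rootSet`): zero-freeness on the half-plane
  propagates from capacity `c` to `c - δ_z`, unless `Z(c - δ_z)` vanishes identically in `a_z`.

These are exactly the two outputs of `MonomerDimer.heilmannLieb` that the downstream files consume,
now available for any bond data once `Z ≠ 0` on `{ε Re a_x > 0}` is known (for exponential bond data
`MonomerDimer.Z_ne_zero_of_re_pos` supplies it, so nothing here is circular or conditional on a fact).

Honest framing: finite polynomial algebra over `ℂ`; no statement about the `U(N)` model, `β > 0`,
the continuum or the summit's `QCD` conjunct is made; the `U(N)` zero-freeness is NOT asserted here.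

## References

* M. Salmhofer, E. Seiler, *Proof of chiral symmetry breaking in strongly coupled lattice gauge
  theory*, Commun. Math. Phys. 139 (1991) 395–432: Thm. 3.6, (3.28), Thm. 3.8, Remark 4.10 (3);
  Erratum ibid. 146 (1992) 637–638, (5). [SalmhoferSeiler1991] [SalmhoferSeiler1992Erratum]
* O. J. Heilmann, E. H. Lieb, *Theory of monomer–dimer systems*, Commun. Math. Phys. 25 (1972)
  190–232: Thm. 4.6, Lemma 4.7 (the ratio bounds). [HeilmannLieb1972]
* C. Hall, D. Puder, W. F. Sawin, *Ramanujan coverings of graphs*, Adv. Math. 323 (2018) 367–410,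
  §2.2 (the `d`-matching polynomial, real-rootedness), §5.2 (`Γ = U(d)`). [HallPuderSawin2018]
* N. Amini, *Stable multivariate generalizations of matching polynomials*, arXiv:1905.02264,
  Thm. 3.7. [Amini2019]
-/

noncomputable section

open MvPolynomial Finset

namespace Literature.MathematicalPhysics.StatisticalMechanics

namespace MonomerDimer

variable {V β : Type*}

/-! ### Exponential site data -/

/-- The Taylor data `a^j / j!` of `e^{a σ}`: the site factor of a monomer activity `a`.
[cite: SalmhoferSeiler1991, (3.5) and Def. 3.3(1)] -/
def expData (a : ℂ) : ℕ → ℂ := fun j => a ^ j / (Nat.factorial j : ℂ)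

/-- `a^j/j!` are exponential Taylor data. [cite: SalmhoferSeiler1991, (3.5)] -/
theorem isExpData_expData (a : ℂ) : IsExpData a (expData a) := by
  refine ⟨by simp [expData], fun j => ?_⟩
  have hj : ((Nat.factorial j : ℕ) : ℂ) ≠ 0 := by exact_mod_cast (Nat.factorial_pos j).ne'
  have hj1 : ((j : ℂ) + 1) ≠ 0 := by exact_mod_cast (Nat.succ_ne_zero j)
  show ((j : ℂ) + 1) * (a ^ (j + 1) / ((j + 1).factorial : ℂ)) = a * (a ^ j / (j.factorial : ℂ))
  rw [Nat.factorial_succ, Nat.cast_mul, pow_succ]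
  push_cast
  field_simp

/-- Exponential Taylor data with parameter `a` ARE `a^j/j!` (uniqueness of the solution of
`e₀ = 1`, `(j+1) e_{j+1} = a e_j`). [cite: SalmhoferSeiler1991, (3.5)] -/
theorem IsExpData.eq_expData {a : ℂ} {e : ℕ → ℂ} (h : IsExpData a e) : e = expData a := by
  funext j
  induction j with
  | zero => simp [expData, h.1]
  | succ j ih =>
    have hrec := h.2 j
    have hj1 : ((j : ℂ) + 1) ≠ 0 := by exact_mod_cast (Nat.succ_ne_zero j)
    have : e (j + 1) = a * e j / ((j : ℂ) + 1) := by
      rw [eq_div_iff hj1, mul_comm]; exact hrec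
    rw [this, ih]
    unfold expData
    rw [Nat.factorial_succ, Nat.cast_mul, pow_succ]
    push_cast
    field_simp

section Activity

variable [Fintype V] [Fintype β] [DecidableEq V]
variable (D : ℕ) (s t : β → V) (f : V → ℕ → ℂ) (g : β → ℕ → ℂ) (c : V →₀ ℕ) (z : V)

/-- The Boltzmann polynomial WITHOUT the site factor at `z`:
`∏_{x ≠ z} F_x(σ_x) · ∏_b B_b(σ_{s b} σ_{t b})`. [cite: SalmhoferSeiler1991, (3.1)] -/
def restFactor : MvPolynomial V ℂ :=
  (∏ x ∈ univ.erase z, siteFactor D f x) * ∏ b, bondFactor D s t g b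

/-- The coefficient `R_j(c) = [σ^c](σ_z^j · rest)`: the weight of the configurations in which
exactly `j` of the `c_z` units of capacity at `z` are monomers. [cite: SalmhoferSeiler1991, (3.7)] -/
def restCoeff (j : ℕ) : ℂ :=
  coeff c (X z ^ j * restFactor D s t f g z)

/-- **The activity polynomial at `z`**: `P_{c,z}(X) = ∑_{j ≤ D} (R_j(c)/j!) X^j ∈ ℂ[X]` — the
capacity partition function `Z(c)` as a function of the monomer activity `a_z` of the single site
`z`, all other data frozen. [cite: HeilmannLieb1972, (4.11)] -/
def siteActivityPoly : Polynomial ℂ :=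
  ∑ j ∈ range (D + 1),
    Polynomial.C (restCoeff D s t f g c z j / (Nat.factorial j : ℂ)) * Polynomial.X ^ j

variable {D s t f g c z}

omit [Fintype V] [Fintype β] in
/-- The site factor with exponential data `e^{w σ_z}` at `z`. [cite: SalmhoferSeiler1991, (3.5)] -/
private theorem siteFactor_update_self (w : ℂ) :
    siteFactor D (Function.update f z (expData w)) z =
      ∑ j ∈ range (D + 1), C (w ^ j / (Nat.factorial j : ℂ)) * X z ^ j := by
  unfold siteFactor
  refine Finset.sum_congr rfl fun j _ => ?_
  rw [Function.update_self]
  rfl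

omit [Fintype V] [Fintype β] in
/-- Updating the data at `z` does not change the other site factors. [folklore] -/
private theorem siteFactor_update_of_ne (w : ℂ) {x : V} (hx : x ≠ z) :
    siteFactor D (Function.update f z (expData w)) x = siteFactor D f x := by
  unfold siteFactor
  refine Finset.sum_congr rfl fun j _ => ?_
  rw [Function.update_of_ne hx]

/-- Updating the data at `z` does not change the rest factor. [folklore] -/
private theorem restFactor_update (w : ℂ) :
    restFactor D s t (Function.update f z (expData w)) g z = restFactor D s t f g z := by
  unfold restFactor
  congr 1
  exact Finset.prod_congr rfl fun x hx => siteFactor_update_of_ne w (Finset.ne_of_mem_erase hx)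

/-- The Boltzmann polynomial with activity `w` at `z` splits off the `z`-site factor. [folklore] -/
private theorem boltzmann_update (w : ℂ) :
    boltzmann D s t (Function.update f z (expData w)) g =
      (∑ j ∈ range (D + 1), C (w ^ j / (Nat.factorial j : ℂ)) * X z ^ j) *
        restFactor D s t f g z := by
  rw [← restFactor_update (D := D) (s := s) (t := t) (f := f) (g := g) (z := z) w,
    ← siteFactor_update_self (D := D) (f := f) (z := z) w]
  unfold boltzmann restFactor
  rw [← mul_assoc, Finset.mul_prod_erase _ _ (Finset.mem_univ z)]

/-- `Z(c)` at activity `w` in `z` is `∑_j (w^j/j!) R_j(c)`. [cite: SalmhoferSeiler1991, (3.7)] -/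
private theorem Z_update_eq_sum (w : ℂ) (c' : V →₀ ℕ) :
    Z D s t (Function.update f z (expData w)) g c' =
      ∑ j ∈ range (D + 1), w ^ j / (Nat.factorial j : ℂ) * restCoeff D s t f g c' z j := by
  unfold Z restCoeff
  rw [boltzmann_update, Finset.sum_mul, coeff_sum]
  refine Finset.sum_congr rfl fun j _ => ?_
  rw [mul_assoc, coeff_C_mul]

/-- `R_j(c) = 0` for `j > c_z`: more than `c_z` monomers do not fit at `z`. [folklore] -/
private theorem restCoeff_eq_zero_of_lt {j : ℕ} (hj : c z < j) : restCoeff D s t f g c z j = 0 := by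
  unfold restCoeff
  rw [X_pow_eq_monomial, coeff_monomial_mul']
  have : ¬ Finsupp.single z j ≤ c := by
    intro h
    have := h z
    rw [Finsupp.single_eq_same] at this
    omega
  rw [if_neg this]

/-- `R_{j+1}(c) = R_j(c - δ_z)` for `z ∈ supp c`: one more monomer at `z` is one unit of capacity
less for the rest. [cite: HeilmannLieb1972, (4.11)] -/
theorem restCoeff_succ (hz : z ∈ c.support) (j : ℕ) :
    restCoeff D s t f g c z (j + 1) = restCoeff D s t f g (c - Finsupp.single z 1) z j := by
  unfold restCoeff
  rw [pow_succ', mul_assoc, coeff_X_mul', if_pos hz]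

/-- **`P_{c,z}(w) = Z(c)` with activity `w` at `z`.** [cite: HeilmannLieb1972, (4.11)] -/
theorem eval_siteActivityPoly (w : ℂ) :
    (siteActivityPoly D s t f g c z).eval w = Z D s t (Function.update f z (expData w)) g c := by
  unfold siteActivityPoly
  rw [Polynomial.eval_finsetSum, Z_update_eq_sum]
  refine Finset.sum_congr rfl fun j _ => ?_
  rw [Polynomial.eval_mul, Polynomial.eval_C, Polynomial.eval_pow, Polynomial.eval_X]
  ring

/-- The coefficients of the activity polynomial. [folklore] -/
private theorem coeff_siteActivityPoly (n : ℕ) :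
    (siteActivityPoly D s t f g c z).coeff n =
      if n < D + 1 then restCoeff D s t f g c z n / (Nat.factorial n : ℂ) else 0 := by
  unfold siteActivityPoly
  rw [Polynomial.finsetSum_coeff]
  simp_rw [Polynomial.coeff_C_mul_X_pow]
  rw [Finset.sum_ite_eq (range (D + 1)) n]
  simp only [Finset.mem_range]

/-- **`deg P_{c,z} ≤ c_z`.** [cite: HeilmannLieb1972, Lemma 4.7] -/
theorem natDegree_siteActivityPoly_le :
    (siteActivityPoly D s t f g c z).natDegree ≤ c z := by
  rw [Polynomial.natDegree_le_iff_coeff_eq_zero]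
  intro n hn
  have hn' : c z < n := by exact_mod_cast hn
  rw [coeff_siteActivityPoly]
  split_ifs
  · rw [restCoeff_eq_zero_of_lt hn', zero_div]
  · rfl

/-- **Lowering the capacity at `z` is differentiation in the activity `a_z`:**
`P'_{c,z}(w) = Z(c - δ_z)` (activity `w` at `z`), for `z ∈ supp c`, `c_z ≤ D`.
[cite: HeilmannLieb1972, (4.11)] -/
theorem eval_derivative_siteActivityPoly (hz : z ∈ c.support) (hc : c z ≤ D) (w : ℂ) :
    (Polynomial.derivative (siteActivityPoly D s t f g c z)).eval w =
      Z D s t (Function.update f z (expData w)) g (c - Finsupp.single z 1) := by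
  unfold siteActivityPoly
  rw [Polynomial.derivative_sum, Polynomial.eval_finsetSum, Z_update_eq_sum]
  -- right side: the top term `j = D` vanishes since `(c - δ_z) z = c z - 1 < D`
  rw [Finset.sum_range_succ (fun j => w ^ j / (Nat.factorial j : ℂ) *
    restCoeff D s t f g (c - Finsupp.single z 1) z j)]
  have htop : restCoeff D s t f g (c - Finsupp.single z 1) z D = 0 := by
    apply restCoeff_eq_zero_of_lt
    have hcz : c z ≠ 0 := Finsupp.mem_support_iff.1 hz
    simp only [Finsupp.coe_tsub, Pi.sub_apply, Finsupp.single_eq_same]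
    omega
  rw [htop, mul_zero, add_zero]
  -- left side: peel off `j = 0` (derivative of a constant) and shift the index
  rw [Finset.sum_range_succ' (fun j => Polynomial.eval w
    (Polynomial.derivative (Polynomial.C (restCoeff D s t f g c z j / (Nat.factorial j : ℂ)) *
      Polynomial.X ^ j)))]
  have h0 : Polynomial.eval w (Polynomial.derivative
      (Polynomial.C (restCoeff D s t f g c z 0 / (Nat.factorial 0 : ℂ)) * Polynomial.X ^ 0)) = 0 := by
    rw [pow_zero, mul_one, Polynomial.derivative_C, Polynomial.eval_zero]
  rw [h0, add_zero]
  refine Finset.sum_congr rfl fun j _ => ?_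
  rw [Polynomial.derivative_C_mul_X_pow, Polynomial.eval_mul, Polynomial.eval_C,
    Polynomial.eval_pow, Polynomial.eval_X, Nat.add_sub_cancel, restCoeff_succ hz j,
    Nat.factorial_succ]
  have hj : ((Nat.factorial j : ℕ) : ℂ) ≠ 0 := by exact_mod_cast (Nat.factorial_pos j).ne'
  have hj1 : ((j : ℂ) + 1) ≠ 0 := by exact_mod_cast (Nat.succ_ne_zero j)
  push_cast
  field_simp

omit [Fintype V] [Fintype β] in
/-- With the site data at `z` being exponential with parameter `a_z`, the frozen system at activity
`a_z` is the original one. [cite: SalmhoferSeiler1991, (3.5)] -/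
private theorem update_eq_self_of_isExpData {a : ℂ} (hf : IsExpData a (f z)) :
    Function.update f z (expData a) = f := by
  rw [← hf.eq_expData, Function.update_eq_self]

/-! ### Zero-freeness in the activity at one site ⇒ Heilmann–Lieb's ratio bounds -/

/-- If `Z(c) ≠ 0` whenever the activity at `z` has `ε Re > 0` (other data frozen), every root `r` of
the activity polynomial has `ε Re r ≤ 0`. [cite: HeilmannLieb1972, Thm. 4.6] -/
theorem re_root_nonpos_of_zeroFree {ε : ℝ}
    (hZ : ∀ w : ℂ, 0 < ε * w.re → Z D s t (Function.update f z (expData w)) g c ≠ 0)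
    {r : ℂ} (hr : r ∈ (siteActivityPoly D s t f g c z).roots) : ε * r.re ≤ 0 := by
  by_contra h
  have h : 0 < ε * r.re := not_le.mp h
  have hroot := (Polynomial.mem_roots'.1 hr).2
  rw [Polynomial.IsRoot.def, eval_siteActivityPoly] at hroot
  exact hZ r h hroot

/-- **Zero-freeness in the activity at `z` alone gives the Heilmann–Lieb ratio bound**
`‖Z(c - δ_z)/Z(c)‖ ≤ c_z / (ε Re a_z)` — for ARBITRARY bond Taylor data `g` (in particular the
non-exponential `U(N)` data), by `Z(c - δ_z)/Z(c) = P'/P (a_z) = ∑_{roots r} (a_z - r)⁻¹` and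
`|a_z - r| ≥ ε Re a_z - ε Re r ≥ ε Re a_z`.  (For exponential bond data this is the bound inside
`MonomerDimer.heilmannLieb`, there proved by the Heilmann–Lieb recursion.)
[cite: HeilmannLieb1972, Lemma 4.7][cite: SalmhoferSeiler1992Erratum, (5)] -/
theorem norm_Z_sub_single_div_Z_le_of_zeroFree {a : ℂ} (hf : IsExpData a (f z))
    (hz : z ∈ c.support) (hc : c z ≤ D) {ε : ℝ} (hε : ε = 1 ∨ ε = -1) (ha : 0 < ε * a.re)
    (hZ : ∀ w : ℂ, 0 < ε * w.re → Z D s t (Function.update f z (expData w)) g c ≠ 0) :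
    ‖Z D s t f g (c - Finsupp.single z 1) / Z D s t f g c‖ ≤ c z / (ε * a.re) := by
  set P := siteActivityPoly D s t f g c z with hP
  have hfa := update_eq_self_of_isExpData (f := f) (z := z) hf
  have hPa : P.eval a = Z D s t f g c := by rw [hP, eval_siteActivityPoly, hfa]
  have hP'a : (Polynomial.derivative P).eval a = Z D s t f g (c - Finsupp.single z 1) := by
    rw [hP, eval_derivative_siteActivityPoly hz hc, hfa]
  have hPa0 : P.eval a ≠ 0 := by rw [hPa, ← hfa]; exact hZ a ha
  have hsplit : P.Splits := IsAlgClosed.splits P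
  rw [← hPa, ← hP'a, hsplit.eval_derivative_div_eval_of_ne_zero hPa0]
  -- each root term has modulus ≤ (ε Re a)⁻¹
  have hterm : ∀ r ∈ P.roots, ‖1 / (a - r)‖ ≤ (ε * a.re)⁻¹ := by
    intro r hr
    have hr' := re_root_nonpos_of_zeroFree (D := D) (s := s) (t := t) (f := f) (g := g)
      (c := c) (z := z) hZ hr
    have hεabs : ∀ x : ℝ, ε * x ≤ |x| := fun x => by
      rcases hε with h | h <;> subst h <;> simp [le_abs_self, neg_le_abs]
    have hre : ε * a.re ≤ ‖a - r‖ := by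
      calc ε * a.re ≤ ε * a.re - ε * r.re := by linarith
        _ = ε * (a - r).re := by rw [Complex.sub_re]; ring
        _ ≤ |(a - r).re| := hεabs _
        _ ≤ ‖a - r‖ := Complex.abs_re_le_norm _
    rw [norm_div, norm_one, one_div]
    exact inv_anti₀ ha hre
  calc ‖(P.roots.map fun r => 1 / (a - r)).sum‖
      ≤ (P.roots.map fun r => ‖1 / (a - r)‖).sum := by
        have := norm_multiset_sum_le (P.roots.map fun r => 1 / (a - r))
        rwa [Multiset.map_map] at this
    _ ≤ Multiset.card (P.roots.map fun r => ‖1 / (a - r)‖) • (ε * a.re)⁻¹ :=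
        Multiset.sum_le_card_nsmul _ _ (fun x hx => by
          obtain ⟨r, hr, rfl⟩ := Multiset.mem_map.1 hx
          exact hterm r hr)
    _ ≤ (c z : ℝ) * (ε * a.re)⁻¹ := by
        rw [Multiset.card_map, nsmul_eq_mul]
        refine mul_le_mul_of_nonneg_right ?_ (inv_nonneg.2 ha.le)
        exact_mod_cast (Polynomial.card_roots' P).trans natDegree_siteActivityPoly_le
    _ = c z / (ε * a.re) := by rw [div_eq_mul_inv]

/-- The sign information of Heilmann–Lieb's Lemma 4.7 from zero-freeness alone:
`ε Re (Z(c - δ_z)/Z(c)) ≥ 0`, since every root term `(a_z - r)⁻¹` has `ε Re > 0`.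
[cite: HeilmannLieb1972, Lemma 4.7] -/
theorem re_Z_sub_single_div_Z_nonneg_of_zeroFree {a : ℂ} (hf : IsExpData a (f z))
    (hz : z ∈ c.support) (hc : c z ≤ D) {ε : ℝ} (ha : 0 < ε * a.re)
    (hZ : ∀ w : ℂ, 0 < ε * w.re → Z D s t (Function.update f z (expData w)) g c ≠ 0) :
    0 ≤ ε * (Z D s t f g (c - Finsupp.single z 1) / Z D s t f g c).re := by
  set P := siteActivityPoly D s t f g c z with hP
  have hfa := update_eq_self_of_isExpData (f := f) (z := z) hf
  have hPa : P.eval a = Z D s t f g c := by rw [hP, eval_siteActivityPoly, hfa]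
  have hP'a : (Polynomial.derivative P).eval a = Z D s t f g (c - Finsupp.single z 1) := by
    rw [hP, eval_derivative_siteActivityPoly hz hc, hfa]
  have hPa0 : P.eval a ≠ 0 := by rw [hPa, ← hfa]; exact hZ a ha
  have hsplit : P.Splits := IsAlgClosed.splits P
  rw [← hPa, ← hP'a, hsplit.eval_derivative_div_eval_of_ne_zero hPa0]
  have hre : ((P.roots.map fun r => 1 / (a - r)).sum).re =
      ((P.roots.map fun r => (1 / (a - r)).re)).sum := by
    rw [show ((P.roots.map fun r => 1 / (a - r)).sum).re =
        Complex.reAddGroupHom ((P.roots.map fun r => 1 / (a - r)).sum) from rfl,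
      map_multiset_sum, Multiset.map_map]
    rfl
  rw [hre, ← Multiset.sum_map_mul_left]
  refine Multiset.sum_nonneg fun x hx => ?_
  obtain ⟨r, hr, rfl⟩ := Multiset.mem_map.1 hx
  have hr' := re_root_nonpos_of_zeroFree (D := D) (s := s) (t := t) (f := f) (g := g)
    (c := c) (z := z) hZ hr
  have hpos : 0 < ε * (a - r).re := by rw [Complex.sub_re]; nlinarith
  rw [one_div, Complex.inv_re, ← mul_div_assoc]
  exact div_nonneg hpos.le (Complex.normSq_nonneg _)

/-! ### Gauss–Lucas: zero-freeness propagates to lower capacity -/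

omit [Fintype V] [Fintype β] [DecidableEq V] in
/-- The half-plane `{ε Re ≤ 0}` is convex. [folklore] -/
private theorem convex_re_halfPlane (ε : ℝ) : Convex ℝ {u : ℂ | ε * u.re ≤ 0} := by
  intro x hx y hy p q hp hq _
  simp only [Set.mem_setOf_eq] at hx hy ⊢
  rw [Complex.add_re, Complex.smul_re, Complex.smul_re, smul_eq_mul, smul_eq_mul]
  nlinarith [hx, hy, hp, hq]

/-- **Zero-freeness propagates from capacity `c` to `c - δ_z` (Gauss–Lucas).**  If `Z(c) ≠ 0`
whenever the activity at `z` has `ε Re > 0` (other data frozen), then so does `Z(c - δ_z)` — unless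
`Z(c - δ_z)` vanishes for every activity at `z` (degenerate frozen data), since the zeros of the
derivative of the activity polynomial lie in the convex hull of its zeros, inside `{ε Re ≤ 0}`.
[cite: HeilmannLieb1972, Thm. 4.6] -/
theorem Z_sub_single_ne_zero_of_zeroFree (hz : z ∈ c.support) (hc : c z ≤ D) {ε : ℝ}
    (hZ : ∀ w : ℂ, 0 < ε * w.re → Z D s t (Function.update f z (expData w)) g c ≠ 0)
    (hne : ∃ w₀ : ℂ, Z D s t (Function.update f z (expData w₀)) g (c - Finsupp.single z 1) ≠ 0)
    {w : ℂ} (hw : 0 < ε * w.re) :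
    Z D s t (Function.update f z (expData w)) g (c - Finsupp.single z 1) ≠ 0 := by
  set P := siteActivityPoly D s t f g c z with hP
  have hP' : Polynomial.derivative P ≠ 0 := by
    obtain ⟨w₀, hw₀⟩ := hne
    intro h0
    apply hw₀
    rw [← eval_derivative_siteActivityPoly hz hc w₀, ← hP, h0, Polynomial.eval_zero]
  have hdeg : 0 < P.degree := by
    rw [← not_le]
    intro hle
    exact hP' (Polynomial.derivative_of_natDegree_zero
      (Polynomial.natDegree_eq_zero_iff_degree_le_zero.2 hle))
  intro h0
  have hmem : w ∈ (Polynomial.derivative P).rootSet ℂ := by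
    rw [Polynomial.mem_rootSet]
    refine ⟨hP', ?_⟩
    rw [Polynomial.coe_aeval_eq_eval, hP, eval_derivative_siteActivityPoly hz hc]
    exact h0
  have hroots : P.rootSet ℂ ⊆ {u : ℂ | ε * u.re ≤ 0} := by
    intro r hr
    rw [Polynomial.mem_rootSet] at hr
    have hr' : r ∈ P.roots := by
      rw [Polynomial.mem_roots hr.1, Polynomial.IsRoot.def, ← Polynomial.coe_aeval_eq_eval]
      exact hr.2
    exact re_root_nonpos_of_zeroFree (D := D) (s := s) (t := t) (f := f) (g := g) (c := c)
      (z := z) hZ hr'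
  have hwle : ε * w.re ≤ 0 :=
    (convexHull_min hroots (convex_re_halfPlane ε))
      (Polynomial.rootSet_derivative_subset_convexHull_rootSet hdeg hmem)
  exact absurd hwle (not_le.mpr hw)

/-! ### Telescoping: volume-independent bounds on all ratios `Z(d)/Z(c)` -/

omit [Fintype V] [Fintype β] [DecidableEq V] in
/-- Removing one unit of capacity lowers the total capacity by one. [folklore] -/
private theorem degree_sub_single_add_one' {c : V →₀ ℕ} {z : V} (hz : z ∈ c.support) :
    (c - Finsupp.single z 1).degree + 1 = c.degree := by
  have hle : Finsupp.single z 1 ≤ c :=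
    Finsupp.single_le_iff.2 (Nat.one_le_iff_ne_zero.2 (Finsupp.mem_support_iff.1 hz))
  conv_rhs => rw [← tsub_add_cancel_of_le hle]
  rw [map_add, Finsupp.degree_single]

omit [Fintype V] [Fintype β] [DecidableEq V] in
/-- A proper sub-capacity has smaller total capacity. [folklore] -/
private theorem degree_lt_of_le_of_ne' {c d : V →₀ ℕ} (hdc : d ≤ c) (hne : d ≠ c) :
    d.degree < c.degree := by
  have hcd : c = d + (c - d) := (add_tsub_cancel_of_le hdc).symm
  have hne' : c - d ≠ 0 := by
    intro h
    exact hne (by rw [hcd, h, add_zero])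
  have hpos : 0 < (c - d).degree := Nat.pos_of_ne_zero (mt (Finsupp.degree_eq_zero_iff _).1 hne')
  rw [hcd, map_add]
  omega

omit [Fintype V] [Fintype β] [DecidableEq V] in
/-- Telescoping of one-step ratio bounds: if along every admissible capacity `Z ≠ 0` and
`‖Z(c - δ_z)/Z(c)‖ ≤ K`, then `‖Z(d)/Z(c)‖ ≤ K^{|c| - |d|}` for `d ≤ c`. [folklore] -/
private theorem norm_div_le_pow_of_step' {Zf : (V →₀ ℕ) → ℂ} {P : (V →₀ ℕ) → Prop}
    (hP : ∀ c z, P c → z ∈ c.support → P (c - Finsupp.single z 1)) {K : ℝ} (hK : 0 ≤ K)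
    (hstep : ∀ c, P c → Zf c ≠ 0 ∧ ∀ z ∈ c.support, ‖Zf (c - Finsupp.single z 1) / Zf c‖ ≤ K)
    {c d : V →₀ ℕ} (hdc : d ≤ c) (hPc : P c) :
    ‖Zf d / Zf c‖ ≤ K ^ (c.degree - d.degree) := by
  suffices H : ∀ k (c : V →₀ ℕ), c.degree - d.degree = k → d ≤ c → P c →
      ‖Zf d / Zf c‖ ≤ K ^ (c.degree - d.degree) from H _ c rfl hdc hPc
  intro k
  induction k with
  | zero =>
    intro c hk hdc hPc
    have hdc' : d = c := by
      by_contra hne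
      have := degree_lt_of_le_of_ne' hdc hne
      omega
    subst hdc'
    rw [hk, pow_zero, div_self (hstep d hPc).1, norm_one]
  | succ k ih =>
    intro c hk hdc hPc
    have hne : d ≠ c := by rintro rfl; simp at hk
    obtain ⟨z, hz⟩ : ∃ z, d z < c z := by
      by_contra h
      exact hne (le_antisymm hdc fun x => not_lt.1 (not_exists.1 h x))
    have hzs : z ∈ c.support := Finsupp.mem_support_iff.2 (by omega)
    set c' := c - Finsupp.single z 1 with hc'
    have hdc'' : d ≤ c' := by
      intro x
      rw [hc', Finsupp.tsub_apply]
      by_cases hx : x = z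
      · subst hx; rw [Finsupp.single_eq_same]; omega
      · rw [Finsupp.single_eq_of_ne hx]; simpa using hdc x
    have hdeg := degree_sub_single_add_one' hzs
    rw [← hc'] at hdeg
    have hk' : c'.degree - d.degree = k := by omega
    obtain ⟨hZc, hzc⟩ := hstep c hPc
    have hZc' : Zf c' ≠ 0 := (hstep c' (hP c z hPc hzs)).1
    have h1 := ih c' hk' hdc'' (hP c z hPc hzs)
    have h2 := hzc z hzs
    rw [hk'] at h1
    rw [hk, show Zf d / Zf c = (Zf d / Zf c') * (Zf c' / Zf c) by field_simp, norm_mul, pow_succ]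
    exact mul_le_mul h1 h2 (norm_nonneg _) (pow_nonneg hK _)

/-- **Volume-independent bounds on all correlation ratios from zero-freeness alone**,
`ε Re a_x ≥ ρ > 0`: if for every capacity `c' ≤ c` and every site `z` the frozen system has
`Z(c') ≠ 0` whenever the activity at `z` has `ε Re > 0`, then `‖Z(d)/Z(c)‖ ≤ (D/ρ)^{|c| - |d|}`
for all `d ≤ c ≤ D` — the conclusion of `MonomerDimer.norm_Z_div_Z_le_of_re` (there: exponential
bond data, Heilmann–Lieb recursion), here for ARBITRARY bond Taylor data (e.g. the `U(N)` data, whose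
zero-freeness is the `d`-matching-polynomial theorem of [HallPuderSawin2018]/[Amini2019] and is NOT
asserted in this file).  These ratios are the correlation functions `Z_{G-S}/Z_G`, so this is the
volume-uniform bound of the Erratum to Thm. 3.11 / the Vitali input of Thm. 3.8.
[cite: SalmhoferSeiler1992Erratum, (5)][cite: HeilmannLieb1972, Lemma 4.7] -/
theorem norm_Z_div_Z_le_of_zeroFree {a : V → ℂ} (hf : ∀ x, IsExpData (a x) (f x))
    (hg : ∀ b, g b 0 = 1) {ε : ℝ} (hε : ε = 1 ∨ ε = -1) {ρ : ℝ} (hρ : 0 < ρ)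
    (ha : ∀ x, ρ ≤ ε * (a x).re) {c d : V →₀ ℕ} (hdc : d ≤ c) (hc : ∀ x, c x ≤ D)
    (hZ : ∀ c' : V →₀ ℕ, c' ≤ c → ∀ (z : V) (w : ℂ), 0 < ε * w.re →
      Z D s t (Function.update f z (expData w)) g c' ≠ 0) :
    ‖Z D s t f g d / Z D s t f g c‖ ≤ (D / ρ) ^ (c.degree - d.degree) := by
  refine norm_div_le_pow_of_step' (P := fun c' => c' ≤ c)
    (fun c' z hc' _ => (tsub_le_self (b := Finsupp.single z 1)).trans hc') (by positivity)
    (fun c' hc' => ?_) hdc le_rfl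
  have hc'D : ∀ x, c' x ≤ D := fun x => (hc' x).trans (hc x)
  -- `Z(c') ≠ 0`: `Z(0) = 1`; otherwise freeze a site of the support at its own activity
  have hZc' : Z D s t f g c' ≠ 0 := by
    by_cases h0 : c' = 0
    · subst h0
      rw [Z_zero (fun x => (hf x).1) hg]
      exact one_ne_zero
    · obtain ⟨z, hz⟩ := Finsupp.support_nonempty_iff.2 h0
      have := hZ c' hc' z (a z) ((hρ.trans_le (ha z)))
      rwa [update_eq_self_of_isExpData (hf z)] at this
  refine ⟨hZc', fun z hz => ?_⟩
  have h := norm_Z_sub_single_div_Z_le_of_zeroFree (D := D) (s := s) (t := t) (f := f) (g := g)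
    (c := c') (z := z) (hf z) hz (hc'D z) hε (hρ.trans_le (ha z)) (fun w hw => hZ c' hc' z w hw)
  refine h.trans ?_
  calc (c' z : ℝ) / (ε * (a z).re) ≤ D / (ε * (a z).re) :=
        div_le_div_of_nonneg_right (by exact_mod_cast hc'D z) (hρ.le.trans (ha z))
    _ ≤ D / ρ := div_le_div_of_nonneg_left (Nat.cast_nonneg _) hρ (ha z)

end Activity

end MonomerDimer

end Literature.MathematicalPhysics.StatisticalMechanics

end
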